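import Summits.BirchSwinnertonDyer.BirchSwinnertonDyer.Theorems.SignedLowerHalvesSprungLowerDivisibilityAtThreeRankOneReal
import Literature.NumberTheory.EllipticCurves.Sprung2024.ChromaticSmallControlSurjProofs
import HarnessLib

/-!
# Route `SignedLowerHalves`, crux-5 child K1 at analytic rank one: the CONTROL input of the
# per-pair ♯/♭ Main-Conjecture witnesses (`…RankOneReal.lean`, seat k3-c5 g9) DISCHARGED BY NAME
# (cell `bsd-ssimc`, seat `bsd-ssimc-k3c5-kdot-split` g5; `--supports stmt-BirchSwinnertonDyer-19875 --as helper`)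

PARTITION (cell bsd-ssimc): X8 (A8) ∩ Surj(3) ∩ {r_an = 1}, per pair — removes one named input
(`Sprung2024.lem56AllN_sharpFlat_finite_selmer_of_finite_coinvariants`, the surjectivity half of
Sprung 2024 Lemma 5.6) from the four K1 rank-one witness theorems of
`Theorems/SignedLowerHalvesSprungLowerDivisibilityAtThreeRankOneReal.lean` (p492013), feeding the
DISCHARGE `lem56AllN_sharpFlat_finite_selmer_of_finite_coinvariants_holds`
(`Literature/…/Sprung2024/ChromaticSmallControlSurjProofs.lean`, p494709). Remaining named inputs of
these witnesses: Sprung 2012 Thm. 7.14 (`h714`), Thm. 7.16 (`h716`), the period unit at `3` (`h3`),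
Wuthrich 2014 Lemma 20 (`hL20`), GZK (`hGZK`), plus the displayed per-pair certificate. One-line
compositions; closes NOTHING; 0 census moves; K1 stays OPEN class-wide; BSD is not proved by any of this.

References: [Sprung2024] §5.2 Lemma 5.6 (p. 41) and p. 39; [Sprung2012] Thm. 7.14, Thm. 7.16, Main
Conj. 7.21; [GreenbergLNM1716] §3 Lemma 3.1, §4 Lemma 4.2; [Wuthrich2014] Lemma 20.
-/

set_option autoImplicit false
-- justification: the mandated namespace `Summit.BirchSwinnertonDyer.BirchSwinnertonDyer.Theorems`
-- (single-conjunct summit, Sub = Summit) repeats a segment by design (D-0017).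
set_option linter.dupNamespace false

noncomputable section

namespace Summit.BirchSwinnertonDyer.BirchSwinnertonDyer.Theorems.K1RankOne

open scoped Classical NumberField MatrixGroups ModularForm
open NumberField IsDedekindDomain WeierstrassCurve CongruenceSubgroup
  Literature.NumberTheory.EllipticCurves Literature.NumberTheory.EllipticCurves.ModularForms
  Literature.NumberTheory.EllipticCurves.Rank1Residual
  Literature.NumberTheory.EllipticCurves.Rank1Residual.Typed
  Literature.NumberTheory.EllipticCurves.Sprung2017 Literature.NumberTheory.EllipticCurves.Sprung2012
  Literature.NumberTheory.EllipticCurves.Sprung2024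
  Literature.NumberTheory.EllipticCurves.ZpExtension
  Summit.BirchSwinnertonDyer.Rank1Residual.X1.MuLambda
  Summit.BirchSwinnertonDyer.Rank1Residual.Supersingular
  Summit.BirchSwinnertonDyer.BirchSwinnertonDyer.Theorems

/-- **X8 ∧ Surj(3) ∧ `r_an = 1`: Sprung's ♯/♭ Main Conjecture at the pair for the colour carrying the
certificate `(μ, λ)(L^•_3(E)) = (0, 1)`, CONTROL DISCHARGED** —
`sprungSharpFlatMainConjecture_of_lam_eq_one_of_analyticRank_eq_one` with its input `hctrl` (the
surjectivity half of Sprung 2024 Lemma 5.6) supplied by the kernel theorem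
`lem56AllN_sharpFlat_finite_selmer_of_finite_coinvariants_holds`. Remaining named inputs: Thm. 7.14,
Thm. 7.16, the period unit at `3`, Wuthrich Lemma 20, GZK; per pair; closes nothing.
[cite: Sprung2012, Thm. 7.14, Thm. 7.16 and Main Conj. 7.21 (pp. 1504–1505)]
[cite: Sprung2024, §5.2 Lemma 5.6 (p. 41)] [cite: GreenbergLNM1716, §4 Lemma 4.2 (p. 103)]
[cite: Wuthrich2014, Lemma 20 (p. 399)] -/
theorem sprungSharpFlatMainConjecture_of_lam_eq_one_of_analyticRank_eq_one'
    (h714 : thm714_sharpFlatSelmerDual_finite_torsion)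
    (h716 : thm716_sharpFlatCharIdeal_divisibility)
    (h3 : realPeriodRat_eq_unit_mul_plusPeriod_three)
    (hL20 : Wuthrich2014.lemma20_surjective_threeAdic_of_semistable)
    (hGZK : rank_eq_analyticRank_of_analyticRank_le_one)
    (W : WeierstrassCurve ℚ) [W.IsElliptic] [W.IsGloballyMinimal] (p : ℕ) [Fact p.Prime]
    (hX : ClassX8 W p) (hs : Surj W p) (h1 : W.analyticRank = 1) (col : Chroma)
    (hcert : ∀ {N : ℕ} [NeZero N] (f : CuspForm (Gamma0 N) 2), IsNewformOf W f →
      ∀ Lsharp Lflat : IwasawaAlgebra p, IsSprungPair f p (W.frobeniusTrace p) Lsharp Lflat →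
        mu (chromaticL col Lsharp Lflat) = 0 ∧ lam (chromaticL col Lsharp Lflat) = 1) :
    SprungSharpFlatMainConjecture W p col :=
  sprungSharpFlatMainConjecture_of_lam_eq_one_of_analyticRank_eq_one h714 h716
    lem56AllN_sharpFlat_finite_selmer_of_finite_coinvariants_holds h3 hL20 hGZK W p hX hs h1 col hcert

/-- **The Eisenstein half K1 at the pair (`SprungSharpFlatLowerDivisibility W p •`), control
discharged** — `sprungSharpFlatLowerDivisibility_of_lam_eq_one_of_analyticRank_eq_one` with `hctrl`
supplied by `lem56AllN_sharpFlat_finite_selmer_of_finite_coinvariants_holds`. Per pair; closes nothing.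
[cite: Sprung2012, Main Conj. 7.21 (p. 1505)] [cite: Sprung2024, §5.2 Lemma 5.6 (p. 41)] -/
theorem sprungSharpFlatLowerDivisibility_of_lam_eq_one_of_analyticRank_eq_one'
    (h714 : thm714_sharpFlatSelmerDual_finite_torsion)
    (h716 : thm716_sharpFlatCharIdeal_divisibility)
    (h3 : realPeriodRat_eq_unit_mul_plusPeriod_three)
    (hL20 : Wuthrich2014.lemma20_surjective_threeAdic_of_semistable)
    (hGZK : rank_eq_analyticRank_of_analyticRank_le_one)
    (W : WeierstrassCurve ℚ) [W.IsElliptic] [W.IsGloballyMinimal] (p : ℕ) [Fact p.Prime]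
    (hX : ClassX8 W p) (hs : Surj W p) (h1 : W.analyticRank = 1) (col : Chroma)
    (hcert : ∀ {N : ℕ} [NeZero N] (f : CuspForm (Gamma0 N) 2), IsNewformOf W f →
      ∀ Lsharp Lflat : IwasawaAlgebra p, IsSprungPair f p (W.frobeniusTrace p) Lsharp Lflat →
        mu (chromaticL col Lsharp Lflat) = 0 ∧ lam (chromaticL col Lsharp Lflat) = 1) :
    SprungSharpFlatLowerDivisibility W p col :=
  sprungSharpFlatLowerDivisibility_of_lam_eq_one_of_analyticRank_eq_one h714 h716
    lem56AllN_sharpFlat_finite_selmer_of_finite_coinvariants_holds h3 hL20 hGZK W p hX hs h1 col hcert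

/-- **Colour ♯ from ONE odd-level Mazur–Tate certificate, control discharged** —
`sprungSharpFlatMainConjecture_sharp_of_mazurTate_of_analyticRank_eq_one` with `hctrl` supplied by
`lem56AllN_sharpFlat_finite_selmer_of_finite_coinvariants_holds`. Per pair; closes nothing.
[cite: Sprung2012, Thm. 7.16 and Main Conj. 7.21 (pp. 1504–1505)] [cite: Pollack2003, Prop. 6.9 and Prop. 6.10]
[cite: Sprung2024, §5.2 Lemma 5.6 (p. 41)] [cite: Wuthrich2014, Lemma 20 (p. 399)] -/
theorem sprungSharpFlatMainConjecture_sharp_of_mazurTate_of_analyticRank_eq_one'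
    (h714 : thm714_sharpFlatSelmerDual_finite_torsion)
    (h716 : thm716_sharpFlatCharIdeal_divisibility)
    (h3 : realPeriodRat_eq_unit_mul_plusPeriod_three)
    (hL20 : Wuthrich2014.lemma20_surjective_threeAdic_of_semistable)
    (hGZK : rank_eq_analyticRank_of_analyticRank_le_one)
    (W : WeierstrassCurve ℚ) [W.IsElliptic] [W.IsGloballyMinimal] (p : ℕ) [Fact p.Prime]
    (hX : ClassX8 W p) (hs : Surj W p) (h1 : W.analyticRank = 1)
    [NeZero (W.conductorNorm ℤ)] {f₀ : CuspForm (Gamma0 (W.conductorNorm ℤ)) 2} (hf₀ : IsNewformOf W f₀)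
    {n : ℕ} (hn : Odd n) {Θ : IwasawaAlgebra p}
    (hΘ : iwasawaToPowerSeries p Θ =
      ((mazurTateElement f₀ p n).map (algebraMap ℚ ℚ_[p]) : PowerSeries ℚ_[p]))
    (hΘ0 : Θ ≠ 0) (hμ : mu Θ = 0) (hlam : lam Θ = (cyclotomicOmegaPlus p n).natDegree + 1)
    (hlt : lam Θ < p ^ n) :
    SprungSharpFlatMainConjecture W p .sharp :=
  sprungSharpFlatMainConjecture_sharp_of_mazurTate_of_analyticRank_eq_one h714 h716
    lem56AllN_sharpFlat_finite_selmer_of_finite_coinvariants_holds h3 hL20 hGZK W p hX hs h1 hf₀ hn hΘ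
    hΘ0 hμ hlam hlt

/-- **Colour ♭ from ONE even-level Mazur–Tate certificate, control discharged** —
`sprungSharpFlatMainConjecture_flat_of_mazurTate_of_analyticRank_eq_one` with `hctrl` supplied by
`lem56AllN_sharpFlat_finite_selmer_of_finite_coinvariants_holds`. Per pair; closes nothing.
[cite: Sprung2012, Thm. 7.16 and Main Conj. 7.21 (pp. 1504–1505)] [cite: Pollack2003, Prop. 6.9 and Prop. 6.10]
[cite: Sprung2024, §5.2 Lemma 5.6 (p. 41)] [cite: Wuthrich2014, Lemma 20 (p. 399)] -/
theorem sprungSharpFlatMainConjecture_flat_of_mazurTate_of_analyticRank_eq_one'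
    (h714 : thm714_sharpFlatSelmerDual_finite_torsion)
    (h716 : thm716_sharpFlatCharIdeal_divisibility)
    (h3 : realPeriodRat_eq_unit_mul_plusPeriod_three)
    (hL20 : Wuthrich2014.lemma20_surjective_threeAdic_of_semistable)
    (hGZK : rank_eq_analyticRank_of_analyticRank_le_one)
    (W : WeierstrassCurve ℚ) [W.IsElliptic] [W.IsGloballyMinimal] (p : ℕ) [Fact p.Prime]
    (hX : ClassX8 W p) (hs : Surj W p) (h1 : W.analyticRank = 1)
    [NeZero (W.conductorNorm ℤ)] {f₀ : CuspForm (Gamma0 (W.conductorNorm ℤ)) 2} (hf₀ : IsNewformOf W f₀)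
    {n : ℕ} (hn : Even n) {Θ : IwasawaAlgebra p}
    (hΘ : iwasawaToPowerSeries p Θ =
      ((mazurTateElement f₀ p n).map (algebraMap ℚ ℚ_[p]) : PowerSeries ℚ_[p]))
    (hΘ0 : Θ ≠ 0) (hμ : mu Θ = 0) (hlam : lam Θ = (cyclotomicOmegaMinus p n).natDegree + 1)
    (hlt : lam Θ < p ^ n) :
    SprungSharpFlatMainConjecture W p .flat :=
  sprungSharpFlatMainConjecture_flat_of_mazurTate_of_analyticRank_eq_one h714 h716
    lem56AllN_sharpFlat_finite_selmer_of_finite_coinvariants_holds h3 hL20 hGZK W p hX hs h1 hf₀ hn hΘ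
    hΘ0 hμ hlam hlt

end Summit.BirchSwinnertonDyer.BirchSwinnertonDyer.Theorems.K1RankOne

end
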